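import Summits.QuantumAdvantage.QuantumAdvantage.Theorems.SteerDialWindow
import HarnessLib

/-!
# CylinderDial, part 5: POLYLOG WINDOWS — the base range of the frozen-set dial, PROVED up to `|F| ≤ (log₂ n)^g`

Cell decomp-qadv, seat lens-5, generation 13 (node «CylinderDial», §8).  The tree's window theorems
(`SteerDial.windowLoss_of_polyLoss3`, `juntaLoss_of_polyLoss3`; lens-5 g7) freeze a window of CONSTANT width `L`
(`n ≥ 2^(2L+16)`).  The same fold (`SteerDial.wfoldG`, degree `≤ (2m+2)·d`) runs for windows of POLYLOGARITHMIC
width `m ≤ (log₂ n)^g` at the price `c ↦ 2c+g+3` in the degree exponent — and `SpreadDial.PolyLoss3` quantifies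
over EVERY degree exponent with ONE loss exponent `k`.  Hence, granted `PolyLoss3` (26123):

* `cylinderLossPolylog_of_polyLoss3` — every certified identity word `w ∈ {0,1}^m`, `1 ≤ m ≤ (log₂ n)^g`, `m ≤ n`:
  the cylinder `{x ∈ {0,1}^(n+m) : x|_{[n,n+m)} = w}` (exactly `2^n` points) carries `≥ 2^n / n^k` losses of every
  `𝔽₃`-strategy of degree `≤ (log₂ (n+m))^c` — RELATIVE loss density `≥ n^(-k)` on the cylinder, `k = k_P` independent
  of `m`, `g`, `c`;
* `rotCylinderLossPolylog_of_polyLoss3` — the same at every ring offset (rotation symmetry, tree `SteerDial.rotStrat`);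
* `windowLossPolylog_of_polyLoss3` — EVERY content `u ∈ {0,1}^m'` of EVERY window of width `m' + 6 ≤ (log₂ n)^g` at every
  offset (six completion letters `SteerDial.vinvG u`);
* `juntaLossPolylog_of_polyLoss3` — every partial pattern inside such a window.

In the language of the node: `CylLoss3` (hence the `ψ = 1` instance of piece C `CylCover3`, WITHOUT the hypothesis
`AlgSpread3`) is PROVED for every CONTIGUOUS frozen set `F` of size `≤ (log₂ n)^g − 6`, every `g` — the dial's base range
moves from `O(1)` (tree) to polylog.  CEILING of the fold method: the two boundary outputs of the fold absorb the block
parities `parityOn α`, `parityOn β` of the frozen window's answers (`SteerDial.foldBitG`), of `𝔽₃`-degree `≍ m·d`; polylog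
degree forces `m ≤ polylog`.  The asymptotic regime of the dial (`|F| = n^(1/r)`, where the bridge of part 2 bites on the
located core) is therefore NOT reachable by folding — it is piece C proper.
No `sorry`, no new axioms, no instances, no notation; Prop-free.
-/

set_option linter.style.longLine false
set_option linter.dupNamespace false

namespace Summit.QuantumAdvantage.QuantumAdvantage.Theorems.CylinderDial

open Finset
open Literature.Computability.QuantumComplexity Literature.Computability.MetaComplexity
open Literature.Computability.QuantumComplexity.RingHLF
open Summit.QuantumAdvantage.AdviceFreeQNC0
open Summit.QuantumAdvantage.QuantumAdvantage.Theses
open Summit.QuantumAdvantage.QuantumAdvantage.Theorems.SteerDial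

section PolylogWindows
variable {n m : ℕ}

/-- POLYLOG DEGREE BUDGET: for `4 ≤ n`, `m ≤ (log₂ n)^g`, `m ≤ n`:
`2 + (2m+2)·(log₂ (n+m))^c ≤ (log₂ n)^(2c+g+3)`. -/
theorem degree_budget_polylog (g c n m : ℕ) (hn : 4 ≤ n) (hm : m ≤ (Nat.log 2 n) ^ g) (hmn : m ≤ n) :
    2 + (2 * m + 2) * (Nat.log 2 (n + m)) ^ c ≤ (Nat.log 2 n) ^ (2 * c + g + 3) := by
  set L := Nat.log 2 n with hL
  have hL2 : 2 ≤ L := by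
    rw [hL]
    exact Nat.le_log_of_pow_le (by norm_num) (by norm_num; omega)
  have hn0 : n ≠ 0 := by omega
  have hlog : Nat.log 2 (n + m) ≤ L + 1 := by
    calc Nat.log 2 (n + m) ≤ Nat.log 2 (n * 2) := Nat.log_mono_right (by omega)
      _ = L + 1 := by rw [Nat.log_mul_base (by norm_num) hn0]
  have h1 : (Nat.log 2 (n + m)) ^ c ≤ L ^ (2 * c) := by
    calc (Nat.log 2 (n + m)) ^ c ≤ (L + 1) ^ c := Nat.pow_le_pow_left hlog c
      _ ≤ (2 * L) ^ c := Nat.pow_le_pow_left (by omega) c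
      _ = 2 ^ c * L ^ c := by rw [Nat.mul_pow]
      _ ≤ L ^ c * L ^ c := Nat.mul_le_mul_right _ (Nat.pow_le_pow_left (by omega) c)
      _ = L ^ (2 * c) := by rw [← pow_add, two_mul]
  have h2 : 1 ≤ L ^ (2 * c) := Nat.one_le_pow _ _ (by omega)
  have hg1 : 1 ≤ L ^ g := Nat.one_le_pow _ _ (by omega)
  have hL3 : 8 ≤ L ^ 3 := by
    calc 8 = 2 ^ 3 := by norm_num
      _ ≤ L ^ 3 := Nat.pow_le_pow_left hL2 3
  have h3 : 2 * m + 4 ≤ L ^ (g + 3) := by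
    calc 2 * m + 4 ≤ 2 * L ^ g + 4 * L ^ g := by omega
      _ = 6 * L ^ g := by ring
      _ ≤ L ^ 3 * L ^ g := Nat.mul_le_mul_right _ (by omega)
      _ = L ^ (g + 3) := by rw [← pow_add, add_comm]
  calc 2 + (2 * m + 2) * (Nat.log 2 (n + m)) ^ c ≤ 2 + (2 * m + 2) * L ^ (2 * c) :=
        Nat.add_le_add_left (Nat.mul_le_mul_left _ h1) _
    _ ≤ (2 * m + 4) * L ^ (2 * c) := by nlinarith
    _ ≤ L ^ (g + 3) * L ^ (2 * c) := Nat.mul_le_mul_right _ h3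
    _ = L ^ (2 * c + g + 3) := by rw [← pow_add]; ring_nf

/-- **CylinderLossPolylog (PROVED from PolyLoss3).**  For every `g` there is `k` (`= k_P`, the loss exponent of
`PolyLoss3`, uniform in `g` and `c`) such that for every `c`, all large `n`, every `1 ≤ m ≤ (log₂ n)^g` with `m ≤ n`, every
`𝔽₃`-strategy `P` of degree `≤ (log₂ (n+m))^c` on the ring `C_{n+m}` and every CERTIFIED identity word `w ∈ {0,1}^m`:
the cylinder `{x : x|_{[n,n+m)} = w}` (of size `2^n`) contains `≥ 2^n / n^k` losing inputs of `P`. -/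
theorem cylinderLossPolylog_of_polyLoss3 (hP : SpreadDial.PolyLoss3) (g : ℕ) :
    ∃ k : ℕ, ∀ c : ℕ, ∃ n₀ : ℕ, ∀ n ≥ n₀, ∀ m : ℕ, 1 ≤ m → m ≤ (Nat.log 2 n) ^ g → m ≤ n →
      ∀ P : Fin (n + m) → Smolensky.CubeFn (ZMod 3) (n + m),
        (∀ b, P b ∈ Smolensky.lowDeg (ZMod 3) (n + m) ((Nat.log 2 (n + m)) ^ c)) →
          ∀ w α β : Fin m → Bool, ∀ a b : Bool, wordCert w α β a b = true →
            1 / (n : ℝ) ^ k * (2 : ℝ) ^ n ≤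
              ((univ.filter fun x : Fin (n + m) → Bool =>
                (∀ j : Fin m, x (Fin.natAdd n j) = w j) ∧ ¬ RingHLF.Rel x (fun b => decide (P b x = 1))).card : ℝ) := by
  obtain ⟨k, hk⟩ := hP
  refine ⟨k, fun c => ?_⟩
  obtain ⟨n₀, hn₀⟩ := hk (2 * c + g + 3)
  refine ⟨max n₀ 4, fun n hn m hm hmg hmn P hPdeg w α β a b cert => ?_⟩
  have hn₀' : n₀ ≤ n := le_trans (le_max_left _ _) hn
  have hn4 : 4 ≤ n := le_trans (le_max_right _ _) hn
  have hn3 : 3 ≤ n := by omega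
  set S := wfoldG w α β a b P with hS
  have hSdeg : ∀ i, S i ∈ Smolensky.lowDeg (ZMod 3) n ((Nat.log 2 n) ^ (2 * c + g + 3)) := fun i =>
    Smolensky.lowDeg_mono ((Nat.le_add_left _ _).trans (degree_budget_polylog g c n m hn4 hmg hmn))
      (ind_foldBitG_mem_lowDeg _ _ _ _ _ hPdeg i)
  have hwin := hn₀ n hn₀' S hSdeg
  have hsum := card_win_add_card_loss (fun y : Fin n → Bool => RingHLF.Rel y (fun i => decide (S i y = 1)))
  have hloss : 1 / (n : ℝ) ^ k * (2 : ℝ) ^ n ≤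
      ((univ.filter fun y : Fin n → Bool => ¬ RingHLF.Rel y (fun i => decide (S i y = 1))).card : ℝ) := by
    have e : (1 - 1 / (n : ℝ) ^ k) * (2 : ℝ) ^ n = (2 : ℝ) ^ n - 1 / (n : ℝ) ^ k * (2 : ℝ) ^ n := by ring
    linarith
  have htr' : ((univ.filter fun y : Fin n → Bool => ¬ RingHLF.Rel y (fun i => decide (S i y = 1))).card : ℝ) ≤
      ((univ.filter fun x : Fin (n + m) → Bool =>
        (∀ j : Fin m, x (Fin.natAdd n j) = w j) ∧ ¬ RingHLF.Rel x (fun b => decide (P b x = 1))).card : ℝ) := by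
    exact_mod_cast card_loss_wfoldG_le hn3 hm cert P
  exact hloss.trans htr'

/-- **RotCylinderLossPolylog**: the same inside the rotated cylinder `{x : (rot_s x)|_{[n,n+m)} = w}`, every offset `s`
(conjugate `P` by the rotation — `SteerDial.rotStrat`, same degree — and pull the losses back with `RingSymmetry.rel_rot`). -/
theorem rotCylinderLossPolylog_of_polyLoss3 (hP : SpreadDial.PolyLoss3) (g : ℕ) :
    ∃ k : ℕ, ∀ c : ℕ, ∃ n₀ : ℕ, ∀ n ≥ n₀, ∀ m : ℕ, 1 ≤ m → m ≤ (Nat.log 2 n) ^ g → m ≤ n →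
      ∀ P : Fin (n + m) → Smolensky.CubeFn (ZMod 3) (n + m),
        (∀ b, P b ∈ Smolensky.lowDeg (ZMod 3) (n + m) ((Nat.log 2 (n + m)) ^ c)) →
          ∀ w α β : Fin m → Bool, ∀ a b : Bool, wordCert w α β a b = true → ∀ s : ℕ,
            1 / (n : ℝ) ^ k * (2 : ℝ) ^ n ≤
              ((univ.filter fun x : Fin (n + m) → Bool =>
                (∀ j : Fin m, rot s x (Fin.natAdd n j) = w j) ∧
                  ¬ RingHLF.Rel x (fun b => decide (P b x = 1))).card : ℝ) := by
  obtain ⟨k, hk⟩ := cylinderLossPolylog_of_polyLoss3 hP g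
  refine ⟨k, fun c => ?_⟩
  obtain ⟨n₀, hn₀⟩ := hk c
  refine ⟨n₀, fun n hn m hm hmg hmn P hPdeg w α β a b cert s => ?_⟩
  set s' := (n + m - 1) * s with hs'
  have hB := hn₀ n hn m hm hmg hmn (rotStrat s s' P) (fun b => rotStrat_mem_lowDeg s s' hPdeg b) w α β a b cert
  refine hB.trans ?_
  have hss : ∀ y : Fin (n + m) → Bool, rot s (rot s' y) = y := fun y => by
    have hnm : n + m - 1 + 1 = n + m := by omega
    rw [RingSymmetry.rot_rot, show s + s' = (n + m) * s by
      rw [hs']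
      calc s + (n + m - 1) * s = (n + m - 1 + 1) * s := by ring
        _ = (n + m) * s := by rw [hnm]]
    exact RingSymmetry.rot_mul_self s y
  have hle : (univ.filter fun y : Fin (n + m) → Bool =>
        (∀ j : Fin m, y (Fin.natAdd n j) = w j) ∧ ¬ RingHLF.Rel y (fun b => decide (rotStrat s s' P b y = 1))).card ≤
      (univ.filter fun x : Fin (n + m) → Bool =>
        (∀ j : Fin m, rot s x (Fin.natAdd n j) = w j) ∧
          ¬ RingHLF.Rel x (fun b => decide (P b x = 1))).card := by
    refine Finset.card_le_card_of_injOn (rot s') (fun y hy => ?_)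
      (fun y _ y' _ h => RingSymmetry.rot_injective s' h)
    rw [Finset.mem_coe, Finset.mem_filter] at hy ⊢
    refine ⟨mem_univ _, fun j => by rw [hss]; exact hy.2.1 j, fun hwin => hy.2.2 ?_⟩
    have e : (fun b => decide (rotStrat s s' P b y = 1)) =
        rot s (fun b => decide (P b (rot s' y) = 1)) := rfl
    rw [e]
    have := (RingSymmetry.rel_rot s (rot s' y) (fun b => decide (P b (rot s' y) = 1))).2 hwin
    rwa [hss] at this
  exact_mod_cast hle

/-- **WindowLossPolylog: EVERY CONTENT of EVERY POLYLOG WINDOW at every offset.**  `PolyLoss3` ⇒ for every `g` there is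
`k = k_P` such that for every `c`, all large `n`, every width `m'` with `m' + 6 ≤ (log₂ n)^g` and `m' + 6 ≤ n`, every
`𝔽₃`-strategy of degree `≤ (log₂ (n+m'+6))^c` on `C_{n+m'+6}`, every content `u ∈ {0,1}^m'` and every offset `s`: the cylinder
`{x : (rot_s x)_{n+j} = u_j (j < m')}` contains `≥ 2^n/n^k` losing inputs — relative density `≥ 2^(-6)·n^(-k)` of its
`2^(n+6)` points.  (Device, as in the tree: the six letters after the window are the inverse completion `vinvG u`.) -/
theorem windowLossPolylog_of_polyLoss3 (hP : SpreadDial.PolyLoss3) (g : ℕ) :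
    ∃ k : ℕ, ∀ c : ℕ, ∃ n₀ : ℕ, ∀ n ≥ n₀, ∀ m' : ℕ, m' + 6 ≤ (Nat.log 2 n) ^ g → m' + 6 ≤ n →
      ∀ P : Fin (n + (m' + 6)) → Smolensky.CubeFn (ZMod 3) (n + (m' + 6)),
        (∀ b, P b ∈ Smolensky.lowDeg (ZMod 3) (n + (m' + 6)) ((Nat.log 2 (n + (m' + 6))) ^ c)) →
          ∀ u : Fin m' → Bool, ∀ s : ℕ,
            1 / (n : ℝ) ^ k * (2 : ℝ) ^ n ≤
              ((univ.filter fun x : Fin (n + (m' + 6)) → Bool =>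
                (∀ j : Fin m', rot s x (Fin.natAdd n (Fin.castAdd 6 j)) = u j) ∧
                  ¬ RingHLF.Rel x (fun b => decide (P b x = 1))).card : ℝ) := by
  obtain ⟨k, hk⟩ := rotCylinderLossPolylog_of_polyLoss3 hP g
  refine ⟨k, fun c => ?_⟩
  obtain ⟨n₀, hn₀⟩ := hk c
  refine ⟨n₀, fun n hn m' hmg hmn P hPdeg u s => ?_⟩
  have hB := hn₀ n hn (m' + 6) (by omega) hmg hmn P hPdeg (Fin.append u (vinvG u)) _ _ _ _
    (wordCert_append_vinvG u) s
  refine hB.trans ?_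
  have hle : (univ.filter fun x : Fin (n + (m' + 6)) → Bool =>
        (∀ j : Fin (m' + 6), rot s x (Fin.natAdd n j) = Fin.append u (vinvG u) j) ∧
          ¬ RingHLF.Rel x (fun b => decide (P b x = 1))).card ≤
      (univ.filter fun x : Fin (n + (m' + 6)) → Bool =>
        (∀ j : Fin m', rot s x (Fin.natAdd n (Fin.castAdd 6 j)) = u j) ∧
          ¬ RingHLF.Rel x (fun b => decide (P b x = 1))).card := by
    refine Finset.card_le_card (fun x hx => ?_)
    rw [Finset.mem_filter] at hx ⊢
    refine ⟨hx.1, fun j => ?_, hx.2.2⟩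
    have h := hx.2.1 (Fin.castAdd 6 j)
    rw [Fin.append_left] at h
    exact h
  exact_mod_cast hle

/-- **JuntaLossPolylog**: every PARTIAL pattern inside a polylog window (any positions `J`, any prescribed bits). -/
theorem juntaLossPolylog_of_polyLoss3 (hP : SpreadDial.PolyLoss3) (g : ℕ) :
    ∃ k : ℕ, ∀ c : ℕ, ∃ n₀ : ℕ, ∀ n ≥ n₀, ∀ m' : ℕ, m' + 6 ≤ (Nat.log 2 n) ^ g → m' + 6 ≤ n →
      ∀ P : Fin (n + (m' + 6)) → Smolensky.CubeFn (ZMod 3) (n + (m' + 6)),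
        (∀ b, P b ∈ Smolensky.lowDeg (ZMod 3) (n + (m' + 6)) ((Nat.log 2 (n + (m' + 6))) ^ c)) →
          ∀ J : Finset (Fin m'), ∀ u : Fin m' → Bool, ∀ s : ℕ,
            1 / (n : ℝ) ^ k * (2 : ℝ) ^ n ≤
              ((univ.filter fun x : Fin (n + (m' + 6)) → Bool =>
                (∀ j ∈ J, rot s x (Fin.natAdd n (Fin.castAdd 6 j)) = u j) ∧
                  ¬ RingHLF.Rel x (fun b => decide (P b x = 1))).card : ℝ) := by
  obtain ⟨k, hk⟩ := windowLossPolylog_of_polyLoss3 hP g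
  refine ⟨k, fun c => ?_⟩
  obtain ⟨n₀, hn₀⟩ := hk c
  refine ⟨n₀, fun n hn m' hmg hmn P hPdeg J u s => (hn₀ n hn m' hmg hmn P hPdeg u s).trans ?_⟩
  exact_mod_cast Finset.card_le_card (fun x hx => by
    rw [Finset.mem_filter] at hx ⊢
    exact ⟨hx.1, fun j _ => hx.2.1 j, hx.2.2⟩)

end PolylogWindows

end Summit.QuantumAdvantage.QuantumAdvantage.Theorems.CylinderDial
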